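import Literature.Analysis.FluidPDE.FluidComputer.ThresholdLevelTableU
import HarnessLib

/-!
# Kernel run of the re-cut table over the 10⁻² box, chunks 12 … 15 (bp3 gen 13, layer 4: robustness variant U)

HONEST FRAMING: low prior, high value-of-information experiment on Tao's machine paradigm; NOT a
claim that NS blows up.

Four kernel evaluations (`decide +kernel`; no `native_decide`, no extra axioms) of the checker
`runSteps` (`ThresholdLevelCheck.lean`) with the interval gate data `GIu` (all seven data within
relative `10⁻²`) on ≤ 25 steps of `ThresholdLevelTableU.stepsU` at a time, from `Bu i` towards the next chunk's
first level, returning `Bu (i+1)` (`Bu 0 = ThresholdLevelTable.Bc0`).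
-/

namespace Literature.Analysis.FluidPDE.FluidComputer

namespace ThresholdLevelTableU

open ThresholdLevelTable (Bc0 RbIt)

set_option maxHeartbeats 10000000 in
set_option maxRecDepth 200000 in
/-- Chunk 12 of the re-cut table run over the 10⁻² box (steps 300 … 324). [folklore] -/
theorem runU12 : runSteps 60 12 3 GIu RbIt Bu12 chunkU12 1459579868621071 = some Bu13 := by
  decide +kernel

set_option maxHeartbeats 10000000 in
set_option maxRecDepth 200000 in
/-- Chunk 13 of the re-cut table run over the 10⁻² box (steps 325 … 349). [folklore] -/
theorem runU13 : runSteps 60 12 3 GIu RbIt Bu13 chunkU13 1592313552620694 = some Bu14 := by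
  decide +kernel

set_option maxHeartbeats 10000000 in
set_option maxRecDepth 200000 in
/-- Chunk 14 of the re-cut table run over the 10⁻² box (steps 350 … 374). [folklore] -/
theorem runU14 : runSteps 60 12 3 GIu RbIt Bu14 chunkU14 1737139050797562 = some Bu15 := by
  decide +kernel

set_option maxHeartbeats 10000000 in
set_option maxRecDepth 200000 in
/-- Chunk 15 of the re-cut table run over the 10⁻² box (steps 375 … 399). [folklore] -/
theorem runU15 : runSteps 60 12 3 GIu RbIt Bu15 chunkU15 1895113869982896 = some Bu16 := by
  decide +kernel

end ThresholdLevelTableU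

end Literature.Analysis.FluidPDE.FluidComputer
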